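import Summits.Parity.GeneralizedHardyLittlewood.Theorems.BeyondDiagonalBeatsQuarter.OffDiagCoreSplit
import HarnessLib

/-!
# Route `PrimeLevelFamEdge`, crux K_B (stmt-Parity-20343), line `diagonal_kernel_split` rev 4, plan Ω —
# `OffDiagCoreSplit`, part 3 `OffDiagCoreSplitAlgebra`: **the switched pieces with a GENERAL cell weight — linearity,
# domain splits, and the trivial (absolute) ledger of a piece**

`OffDiagCoreSplit` defines the pieces `coreP/coreS/coreL` as `coreWith K` for level kernels `K c A s h₁ q`. The consumers cut
these pieces further by predicates on the WHOLE cell — L7d's funded domain {balanced boxes} × {cells with a long level window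
`h₁Ĥ₂ ≥ ab·q^{ε}`} (lead 16:34:22Z), its complement `U ∪ a8S` displayed as residual hypotheses in L9′ — which a kernel in
`(c, A, s, h₁, q)` cannot see. This file supplies the general-weight form and its algebra:

* `switchedCellW W`, `coreWithW W` (definitions): the switched cell / block piece with a weight
  `W q r l m d₁ d₂ i h₁ s` on the full index; `switchedCell_eq_switchedCellW`, `coreWith_eq_coreWithW` (the kernel pieces are
  the case `W = K (r+1) (ab) s h₁ q`);
* `switchedCellW_congr`, **`switchedCellW_add`**, **`coreWithW_add`** — linearity in the weight (bounded weights; the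
  shifted-lattice summability `hsum` of `OffDiagCoreSplit` splits the `s`-series);
* **`coreWithW_eq_add_indicator`** — for any cell predicate `D`: `coreWithW W = coreWithW (𝟙_D·W) + coreWithW (𝟙_{¬D}·W)`
  (the domain split L7d / L9′ use);
* **`abs_coreWithW_le`** — the absolute ledger of a piece:
  `|coreWithW W G Hf Δ′| ≤ Σ_{q∈G} (4πq̂/q)·Σ_{r,l,m}|c_lc_m|·Σ_{d,i} 𝟙[(l/d₁,r+1)=1]·Σ_{|h₁|≤Hf} 𝟙[h₁ unit]·Σ'_s 𝟙[adm]·‖W‖·‖Φ̂‖`.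

Finite algebra and `tsum` bookkeeping; definitions + theorems; standard axioms. Helper toward `stub_offDiagBelowSlack_io`;
closes nothing.
«The programme SEARCHES and TYPES; no claim about Landau–Siegel zeros, Theorems 1–2 of arXiv:2211.02515 or
a repaired Margin232 until a kernel theorem says so.»
-/

noncomputable section

open Finset Polynomial
open scoped Real FourierTransform

namespace Summit.Parity.GeneralizedHardyLittlewood.Theorems.BeyondDiagonalBeatsQuarter.OffDiag

open Literature.NumberTheory.LFunctions Literature.NumberTheory.LFunctions.KMV2000
open Literature.NumberTheory.Sieve.FriedlanderIwaniecPrimes (fourier2)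
open PeterssonSplit (nearBoxes)

/-! ### §1. The switched cell with a general weight -/

open Classical in
/-- **The switched cell with a general weight `W q r l m d₁ d₂ i h₁ s`** (same shell as `switchedCell`, the kernel replaced by
a weight on the full index). [cite: KowalskiMichelVanderKam2000, §6 p. 19, (21)–(23) p. 12 — derivation] -/
def switchedCellW (W : ℕ → ℕ → ℕ → ℕ → ℕ → ℕ → ℕ × ℕ → ℤ → ℤ → ℂ)
    (Hf : ℕ → ℕ → ℕ → ℕ → ℕ → ℕ → ℕ × ℕ → ℕ) (q : ℕ) (r l m d₁ d₂ : ℕ) (i : ℕ × ℕ) : ℂ :=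
  if Nat.Coprime (l / d₁) (r + 1) then
    ∑ h₁ ∈ Icc (-(Hf q d₁ d₂ (l / d₁) (m / d₂) (r + 1) i : ℤ)) (Hf q d₁ d₂ (l / d₁) (m / d₂) (r + 1) i),
      if IsUnit ((h₁ : ℤ) : ZMod (q * (r + 1))) then
        ∑' s : ℤ,
          if ((switchGcd (r + 1) s h₁ : ℤ) ∣ ((l / d₁ : ℕ) : ℤ) * (m / d₂ : ℕ) ∧
              IsUnit (switchClass (r + 1) (((l / d₁ : ℕ) : ℤ) * (m / d₂ : ℕ)) s h₁)) then
            W q r l m d₁ d₂ i h₁ s *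
              fourier2 (boxWeight q d₁ d₂ (l / d₁) (m / d₂) (r + 1) i) (h₁ / (q * (r + 1) : ℕ))
                ((s : ℝ) / h₁ + (((l / d₁ : ℕ) : ℤ) * (m / d₂ : ℕ) : ℝ) / ((h₁ : ℝ) * (q * (r + 1) : ℕ)))
          else 0
      else 0
  else 0

/-- **The block piece with a general weight**: `Σ_{q∈G} levelBody q Δ′ (switchedCellW W Hf q)` (`0` at `q = 0`).
[cite: KowalskiMichelVanderKam2000, §6 p. 19 — derivation] -/
def coreWithW (W : ℕ → ℕ → ℕ → ℕ → ℕ → ℕ → ℕ × ℕ → ℤ → ℤ → ℂ) (G : Finset ℕ)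
    (Hf : ℕ → ℕ → ℕ → ℕ → ℕ → ℕ → ℕ × ℕ → ℕ) (Δ' : ℝ) : ℝ :=
  ∑ q ∈ G, if hq : q = 0 then 0 else
    (haveI : NeZero q := ⟨hq⟩; levelBody q Δ' (switchedCellW W Hf q))

/-- The kernel cell is the weight cell of `W = K (r+1) (ab) s h₁ q`. [folklore] -/
theorem switchedCell_eq_switchedCellW (K : ℕ → ℤ → ℤ → ℤ → ℕ → ℂ) (Hf : ℕ → ℕ → ℕ → ℕ → ℕ → ℕ → ℕ × ℕ → ℕ)
    (q r l m d₁ d₂ : ℕ) (i : ℕ × ℕ) :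
    switchedCell K Hf q r l m d₁ d₂ i =
      switchedCellW (fun q r l m d₁ d₂ _ h₁ s ↦ K (r + 1) (((l / d₁ : ℕ) : ℤ) * (m / d₂ : ℕ)) s h₁ q) Hf q r l m d₁ d₂ i :=
  rfl

/-- The kernel piece is the weight piece of `W = K (r+1) (ab) s h₁ q`. [folklore] -/
theorem coreWith_eq_coreWithW (K : ℕ → ℤ → ℤ → ℤ → ℕ → ℂ) (G : Finset ℕ)
    (Hf : ℕ → ℕ → ℕ → ℕ → ℕ → ℕ → ℕ × ℕ → ℕ) (Δ' : ℝ) :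
    coreWith K G Hf Δ' =
      coreWithW (fun q r l m d₁ d₂ _ h₁ s ↦ K (r + 1) (((l / d₁ : ℕ) : ℤ) * (m / d₂ : ℕ)) s h₁ q) G Hf Δ' :=
  rfl

/-! ### §2. Linearity in the weight -/

section Linear

variable (Hf : ℕ → ℕ → ℕ → ℕ → ℕ → ℕ → ℕ × ℕ → ℕ)

/-- The admissible-stratum family `s ↦ 𝟙[adm]·W·Φ̂(s)` of a bounded weight is summable (from the shifted-lattice summability of
the box transform). [folklore] -/
theorem summable_adm_mul {q : ℕ} {d₁ d₂ α β c : ℕ} {i : ℕ × ℕ} {ξ₁ τ : ℝ} {h₁ : ℤ}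
    (hΦ : Summable (fun s : ℤ ↦ fourier2 (boxWeight q d₁ d₂ α β c i) ξ₁ ((s : ℝ) / h₁ + τ)))
    (P : ℤ → Prop) [DecidablePred P] {w : ℤ → ℂ} {B : ℝ} (hw : ∀ s, ‖w s‖ ≤ B) :
    Summable (fun s : ℤ ↦ if P s then w s * fourier2 (boxWeight q d₁ d₂ α β c i) ξ₁ ((s : ℝ) / h₁ + τ) else 0) := by
  have hB : 0 ≤ B := (norm_nonneg _).trans (hw 0)
  refine Summable.of_norm_bounded (hΦ.norm.mul_left B) fun s ↦ ?_
  split_ifs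
  · rw [norm_mul]
    exact mul_le_mul_of_nonneg_right (hw s) (norm_nonneg _)
  · rw [norm_zero]; positivity

/-- **The weight cell only sees the weight on its own index** (congruence). [folklore] -/
theorem switchedCellW_congr {W₁ W₂ : ℕ → ℕ → ℕ → ℕ → ℕ → ℕ → ℕ × ℕ → ℤ → ℤ → ℂ} {q r l m d₁ d₂ : ℕ} {i : ℕ × ℕ}
    (h : ∀ h₁ s, W₁ q r l m d₁ d₂ i h₁ s = W₂ q r l m d₁ d₂ i h₁ s) :
    switchedCellW W₁ Hf q r l m d₁ d₂ i = switchedCellW W₂ Hf q r l m d₁ d₂ i := by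
  unfold switchedCellW
  split_ifs with hc
  · refine Finset.sum_congr rfl fun h₁ _ ↦ ?_
    split_ifs with hu
    · exact tsum_congr fun s ↦ by rw [h h₁ s]
    · rfl
  · rfl

/-- **Additivity of the weight cell** for bounded weights (the `s`-series split by `Summable.tsum_add`).
[folklore] -/
theorem switchedCellW_add {W₁ W₂ : ℕ → ℕ → ℕ → ℕ → ℕ → ℕ → ℕ × ℕ → ℤ → ℤ → ℂ} {B₁ B₂ : ℝ}
    (hW₁ : ∀ q r l m d₁ d₂ i h₁ s, ‖W₁ q r l m d₁ d₂ i h₁ s‖ ≤ B₁)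
    (hW₂ : ∀ q r l m d₁ d₂ i h₁ s, ‖W₂ q r l m d₁ d₂ i h₁ s‖ ≤ B₂) {q : ℕ}
    (hsum : ∀ (d₁ d₂ α β c : ℕ) (i : ℕ × ℕ) (ξ₁ τ : ℝ) (h₁ : ℤ), h₁ ≠ 0 →
      Summable (fun s : ℤ ↦ fourier2 (boxWeight q d₁ d₂ α β c i) ξ₁ ((s : ℝ) / h₁ + τ)))
    (hq : 2 ≤ q) (r l m d₁ d₂ : ℕ) (i : ℕ × ℕ) :
    switchedCellW (fun q r l m d₁ d₂ i h₁ s ↦ W₁ q r l m d₁ d₂ i h₁ s + W₂ q r l m d₁ d₂ i h₁ s) Hf q r l m d₁ d₂ i =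
      switchedCellW W₁ Hf q r l m d₁ d₂ i + switchedCellW W₂ Hf q r l m d₁ d₂ i := by
  classical
  unfold switchedCellW
  by_cases hc : Nat.Coprime (l / d₁) (r + 1)
  swap
  · simp only [if_neg hc, add_zero]
  simp only [if_pos hc]
  rw [← Finset.sum_add_distrib]
  refine Finset.sum_congr rfl fun h₁ _ ↦ ?_
  by_cases hu : IsUnit ((h₁ : ℤ) : ZMod (q * (r + 1)))
  swap
  · simp only [if_neg hu, add_zero]
  simp only [if_pos hu]
  have hC : 2 ≤ q * (r + 1) := le_trans hq (Nat.le_mul_of_pos_right q (Nat.succ_pos r))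
  haveI : NeZero (q * (r + 1)) := ⟨by omega⟩
  have hh₁ : h₁ ≠ 0 := intCast_ne_zero_of_isUnit hC hu
  have hΦ := hsum d₁ d₂ (l / d₁) (m / d₂) (r + 1) i ((h₁ : ℝ) / (q * (r + 1) : ℕ))
    ((((l / d₁ : ℕ) : ℤ) * (m / d₂ : ℕ) : ℝ) / ((h₁ : ℝ) * (q * (r + 1) : ℕ))) h₁ hh₁
  have h1 := summable_adm_mul hΦ
    (fun s ↦ (switchGcd (r + 1) s h₁ : ℤ) ∣ ((l / d₁ : ℕ) : ℤ) * (m / d₂ : ℕ) ∧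
      IsUnit (switchClass (r + 1) (((l / d₁ : ℕ) : ℤ) * (m / d₂ : ℕ)) s h₁))
    (w := fun s ↦ W₁ q r l m d₁ d₂ i h₁ s) (fun s ↦ hW₁ q r l m d₁ d₂ i h₁ s)
  have h2 := summable_adm_mul hΦ
    (fun s ↦ (switchGcd (r + 1) s h₁ : ℤ) ∣ ((l / d₁ : ℕ) : ℤ) * (m / d₂ : ℕ) ∧
      IsUnit (switchClass (r + 1) (((l / d₁ : ℕ) : ℤ) * (m / d₂ : ℕ)) s h₁))
    (w := fun s ↦ W₂ q r l m d₁ d₂ i h₁ s) (fun s ↦ hW₂ q r l m d₁ d₂ i h₁ s)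
  rw [← h1.tsum_add h2]
  refine tsum_congr fun s ↦ ?_
  split_ifs <;> ring

/-- **Additivity of the block piece in the weight** (bounded weights; levels `≥ 2`). [folklore] -/
theorem coreWithW_add {W₁ W₂ : ℕ → ℕ → ℕ → ℕ → ℕ → ℕ → ℕ × ℕ → ℤ → ℤ → ℂ} {B₁ B₂ : ℝ}
    (hW₁ : ∀ q r l m d₁ d₂ i h₁ s, ‖W₁ q r l m d₁ d₂ i h₁ s‖ ≤ B₁)
    (hW₂ : ∀ q r l m d₁ d₂ i h₁ s, ‖W₂ q r l m d₁ d₂ i h₁ s‖ ≤ B₂) (G : Finset ℕ) (hG : ∀ q ∈ G, 2 ≤ q)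
    (hsum : ∀ q ∈ G, ∀ (d₁ d₂ α β c : ℕ) (i : ℕ × ℕ) (ξ₁ τ : ℝ) (h₁ : ℤ), h₁ ≠ 0 →
      Summable (fun s : ℤ ↦ fourier2 (boxWeight q d₁ d₂ α β c i) ξ₁ ((s : ℝ) / h₁ + τ))) (Δ' : ℝ) :
    coreWithW (fun q r l m d₁ d₂ i h₁ s ↦ W₁ q r l m d₁ d₂ i h₁ s + W₂ q r l m d₁ d₂ i h₁ s) G Hf Δ' =
      coreWithW W₁ G Hf Δ' + coreWithW W₂ G Hf Δ' := by
  unfold coreWithW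
  rw [← Finset.sum_add_distrib]
  refine Finset.sum_congr rfl fun q hqG ↦ ?_
  have hq2 := hG q hqG
  have hq0 : q ≠ 0 := by omega
  haveI : NeZero q := ⟨hq0⟩
  simp only [dif_neg hq0]
  rw [← levelBody_add]
  exact levelBody_congr q Δ' fun r _ l _ m _ d₁ _ d₂ _ i _ ↦
    switchedCellW_add Hf hW₁ hW₂ (hsum q hqG) hq2 r l m d₁ d₂ i

/-- **Domain split of a piece**: for any cell predicate `D` and bounded weight `W`,
`coreWithW W = coreWithW (𝟙_D·W) + coreWithW (𝟙_{¬D}·W)`. [folklore] -/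
theorem coreWithW_eq_add_indicator {W : ℕ → ℕ → ℕ → ℕ → ℕ → ℕ → ℕ × ℕ → ℤ → ℤ → ℂ} {B : ℝ}
    (hW : ∀ q r l m d₁ d₂ i h₁ s, ‖W q r l m d₁ d₂ i h₁ s‖ ≤ B)
    (D : ℕ → ℕ → ℕ → ℕ → ℕ → ℕ → ℕ × ℕ → ℤ → ℤ → Prop) [∀ q r l m d₁ d₂ i h₁ s, Decidable (D q r l m d₁ d₂ i h₁ s)]
    (G : Finset ℕ) (hG : ∀ q ∈ G, 2 ≤ q)
    (hsum : ∀ q ∈ G, ∀ (d₁ d₂ α β c : ℕ) (i : ℕ × ℕ) (ξ₁ τ : ℝ) (h₁ : ℤ), h₁ ≠ 0 →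
      Summable (fun s : ℤ ↦ fourier2 (boxWeight q d₁ d₂ α β c i) ξ₁ ((s : ℝ) / h₁ + τ))) (Δ' : ℝ) :
    coreWithW W G Hf Δ' =
      coreWithW (fun q r l m d₁ d₂ i h₁ s ↦ if D q r l m d₁ d₂ i h₁ s then W q r l m d₁ d₂ i h₁ s else 0) G Hf Δ' +
        coreWithW (fun q r l m d₁ d₂ i h₁ s ↦ if D q r l m d₁ d₂ i h₁ s then 0 else W q r l m d₁ d₂ i h₁ s) G Hf Δ' := by
  have hB : 0 ≤ B := (norm_nonneg _).trans (hW 0 0 0 0 0 0 (0, 0) 0 0)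
  rw [← coreWithW_add Hf (B₁ := B) (B₂ := B) (fun q r l m d₁ d₂ i h₁ s ↦ by
      split_ifs
      · exact hW q r l m d₁ d₂ i h₁ s
      · rw [norm_zero]; exact hB)
    (fun q r l m d₁ d₂ i h₁ s ↦ by
      split_ifs
      · rw [norm_zero]; exact hB
      · exact hW q r l m d₁ d₂ i h₁ s) G hG hsum Δ']
  unfold coreWithW
  refine Finset.sum_congr rfl fun q hqG ↦ ?_
  have hq0 : q ≠ 0 := by have := hG q hqG; omega
  haveI : NeZero q := ⟨hq0⟩
  simp only [dif_neg hq0]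
  exact levelBody_congr q Δ' fun r _ l _ m _ d₁ _ d₂ _ i _ ↦
    switchedCellW_congr Hf fun h₁ s ↦ by split_ifs <;> simp

end Linear

/-! ### §3. The absolute ledger of a piece -/

/-- `|−re(p·S)| ≤ ‖p‖·‖S‖`. [folklore] -/
theorem abs_neg_re_mul_le (p S : ℂ) : |(-(p * S).re)| ≤ ‖p‖ * ‖S‖ := by
  rw [abs_neg, ← norm_mul]
  exact Complex.abs_re_le_norm _

/-- The norm of the outer prefactor: `‖2q̂·(2π/q)‖ = 4πq̂/q`. [folklore] -/
theorem norm_prefactor (q : ℕ) [NeZero q] : ‖(2 * (qhat q : ℂ) * (2 * π / q))‖ = 4 * π * qhat q / q := by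
  have hq : (0 : ℝ) < q := by exact_mod_cast Nat.pos_of_ne_zero (NeZero.ne q)
  have hqh : 0 ≤ qhat q := (qhat_pos_of_neZero q).le
  rw [show (2 * (qhat q : ℂ) * (2 * π / q)) = ((4 * π * qhat q / q : ℝ) : ℂ) by push_cast; ring,
    Complex.norm_real, Real.norm_of_nonneg (by positivity)]

open Classical in
/-- **The absolute ledger of a weight cell**: `‖switchedCellW W …‖ ≤` the same cell with `W·Φ̂` replaced by `‖W‖·‖Φ̂‖`
(every indicator kept). [folklore] -/
theorem norm_switchedCellW_le (W : ℕ → ℕ → ℕ → ℕ → ℕ → ℕ → ℕ × ℕ → ℤ → ℤ → ℂ)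
    (Hf : ℕ → ℕ → ℕ → ℕ → ℕ → ℕ → ℕ × ℕ → ℕ) {q : ℕ} {B : ℝ}
    (hW : ∀ r l m d₁ d₂ i h₁ s, ‖W q r l m d₁ d₂ i h₁ s‖ ≤ B)
    (hsum : ∀ (d₁ d₂ α β c : ℕ) (i : ℕ × ℕ) (ξ₁ τ : ℝ) (h₁ : ℤ), h₁ ≠ 0 →
      Summable (fun s : ℤ ↦ fourier2 (boxWeight q d₁ d₂ α β c i) ξ₁ ((s : ℝ) / h₁ + τ)))
    (hq : 2 ≤ q) (r l m d₁ d₂ : ℕ) (i : ℕ × ℕ) :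
    ‖switchedCellW W Hf q r l m d₁ d₂ i‖ ≤
      if Nat.Coprime (l / d₁) (r + 1) then
        ∑ h₁ ∈ Icc (-(Hf q d₁ d₂ (l / d₁) (m / d₂) (r + 1) i : ℤ)) (Hf q d₁ d₂ (l / d₁) (m / d₂) (r + 1) i),
          if IsUnit ((h₁ : ℤ) : ZMod (q * (r + 1))) then
            ∑' s : ℤ,
              if ((switchGcd (r + 1) s h₁ : ℤ) ∣ ((l / d₁ : ℕ) : ℤ) * (m / d₂ : ℕ) ∧
                  IsUnit (switchClass (r + 1) (((l / d₁ : ℕ) : ℤ) * (m / d₂ : ℕ)) s h₁)) then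
                ‖W q r l m d₁ d₂ i h₁ s‖ *
                  ‖fourier2 (boxWeight q d₁ d₂ (l / d₁) (m / d₂) (r + 1) i) (h₁ / (q * (r + 1) : ℕ))
                    ((s : ℝ) / h₁ + (((l / d₁ : ℕ) : ℤ) * (m / d₂ : ℕ) : ℝ) / ((h₁ : ℝ) * (q * (r + 1) : ℕ)))‖
              else 0
          else 0
      else 0 := by
  unfold switchedCellW
  by_cases hc : Nat.Coprime (l / d₁) (r + 1)
  swap
  · simp only [if_neg hc, norm_zero, le_refl]
  simp only [if_pos hc]
  refine (norm_sum_le _ _).trans (Finset.sum_le_sum fun h₁ _ ↦ ?_)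
  by_cases hu : IsUnit ((h₁ : ℤ) : ZMod (q * (r + 1)))
  swap
  · simp only [if_neg hu, norm_zero, le_refl]
  simp only [if_pos hu]
  have hC : 2 ≤ q * (r + 1) := le_trans hq (Nat.le_mul_of_pos_right q (Nat.succ_pos r))
  haveI : NeZero (q * (r + 1)) := ⟨by omega⟩
  have hh₁ : h₁ ≠ 0 := intCast_ne_zero_of_isUnit hC hu
  have hΦ := hsum d₁ d₂ (l / d₁) (m / d₂) (r + 1) i ((h₁ : ℝ) / (q * (r + 1) : ℕ))
    ((((l / d₁ : ℕ) : ℤ) * (m / d₂ : ℕ) : ℝ) / ((h₁ : ℝ) * (q * (r + 1) : ℕ))) h₁ hh₁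
  have hs := summable_adm_mul hΦ
    (fun s ↦ (switchGcd (r + 1) s h₁ : ℤ) ∣ ((l / d₁ : ℕ) : ℤ) * (m / d₂ : ℕ) ∧
      IsUnit (switchClass (r + 1) (((l / d₁ : ℕ) : ℤ) * (m / d₂ : ℕ)) s h₁))
    (w := fun s ↦ W q r l m d₁ d₂ i h₁ s) (fun s ↦ hW r l m d₁ d₂ i h₁ s)
  refine (norm_tsum_le_tsum_norm hs.norm).trans (le_of_eq (tsum_congr fun s ↦ ?_))
  split_ifs
  · rw [norm_mul]
  · rw [norm_zero]

end Summit.Parity.GeneralizedHardyLittlewood.Theorems.BeyondDiagonalBeatsQuarter.OffDiag
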